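import Mathlib.CategoryTheory.Limits.FullSubcategory
import Mathlib.CategoryTheory.Limits.Preserves.Shapes.Products
import Literature.AnabelianGeometry.SemiGraphs.QuasiTemperoidsPiProofs
import Literature.AnabelianGeometry.SemiGraphs.BTempCountablyConnectedProofs
import Literature.AnabelianGeometry.SemiGraphs.BTempCoproductsProofs
import Literature.AnabelianGeometry.SemiGraphs.TemperoidsEpiProofs
import Literature.AnabelianGeometry.SemiGraphs.TemperoidsProductDecomposition
import Literature.AlgebraicGeometry.Frobenioids.QuasiTemperoidOrbits
import HarnessLib

/-!
# Semi-graphs of anabelioids, Appendix: quasi-temperoids — Remark A.1.1 (proof)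

Mochizuki, *Semi-graphs of anabelioids*, Publ. RIMS **42** (2006), Appendix, Remark A.1.1, manuscript
p. 79 [cite: MochizukiSemiAnbd2006, Rmk A.1.1 p.79]: "One verifies immediately that a quasi-temperoid is
an almost totally epimorphic category of countably connected type [cf. §0]."  Proof-only companion of
`QuasiTemperoids.lean` (no definitions): the named fact `QuasiTemperoidAlmostTotallyEpimorphic` is
DISCHARGED.  The factors `T[A] ⊆ B^temp(Π)` (`A` connected, `Π` tempered) inherit both properties from
`B^temp(Π)` ([SemiAnbd] Rmk. 3.1.5 as proved in the tree: `BTemp.isAlmostTotallyEpimorphic`,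
`BTemp.isOfCountablyConnectedType`): `T[A]` is closed under coproducts, its inclusion is fully
faithful, and an object of `T[A]` is connected iff its `Π`-set is a single nonempty orbit
(`overPrime_isConnectedObj_iff`, the converse direction transported from the tree's `B^temp(Π, Π°)`
version of abc-iut-L1); the product and equivalence layers are those of Rmk. 3.1.5
(`TemperoidsProductLayer/Decomposition`, `TemperoidsCountablyConnectedTransport`, abc-iut-L3-t10).
Nothing here takes a side on [IUTchIII] Cor. 3.12.
-/

open CategoryTheory CategoryTheory.Limits Topology

namespace Literature.AnabelianGeometry.SemiGraphs

open Literature.AlgebraicGeometry.Frobenioids (IsConnectedObj IsNonemptyObj IsAlmostTotallyEpimorphic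
  IsOfCountablyConnectedType)
open Literature.AlgebraicGeometry.Frobenioids.QuasiTemperoid (IsConnectedQuasiTemperoid BTempRel cosetObj)

universe v₁ u u₁

section OverPrime

variable {G : Type u} [Group G] [TopologicalSpace G] [IsTopologicalGroup G]

/-! ### Connected objects of `T[A]` are exactly the single nonempty orbits -/

/-- **Converse transport**: a connected object of `T[A]` (`A` connected, `Π` tempered) has a connected
underlying object of `B^temp(Π)` — transported from the tree's statement for `B^temp(Π, Π°)`
(`QuasiTemperoid.BTempRel.exists_ρ_eq_of_isConnectedObj`, abc-iut-L1) along
`T[A] ≌ T[Π/Stab a] = B^temp(Π, Stab a)`. [cite: MochizukiSemiAnbd2006, Def A.1(i) p.79] -/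
theorem overPrime_isConnectedObj_obj (hG : IsTempered G) {A : BTemp G} (hA : IsConnectedObj A)
    (X : Over' A) (hX : IsConnectedObj X) : IsConnectedObj X.obj := by
  letI : MulAction G A.obj.V := Action.instMulAction A.obj
  obtain ⟨a⟩ := ((BTemp.isConnectedObj_iff A).mp hA).1
  obtain ⟨hHo, ⟨i⟩⟩ := BTemp.nonempty_quotientObj_iso_of_isConnectedObj hG A hA a
    (MulAction.stabilizer G a) (fun g => MulAction.mem_stabilizer_iff)
  let e : Over' A ≌ BTempRel G (MulAction.stabilizer G a) :=
    (overPrimeCongr i.symm).trans (bTempRelEquivOverPrime G hG _ hHo).symm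
  have hX' : IsConnectedObj (e.functor.obj X) := TemperoidTransport.isConnectedObj_functor_obj e hX
  obtain ⟨x₀⟩ := Literature.AlgebraicGeometry.Frobenioids.QuasiTemperoid.BTempRel.nonempty_of_isConnectedObj _ hX'
  exact (BTemp.isConnectedObj_iff X.obj).mpr ⟨⟨x₀⟩, fun x y => by
    obtain ⟨g, hg⟩ := Literature.AlgebraicGeometry.Frobenioids.QuasiTemperoid.BTempRel.exists_ρ_eq_of_isConnectedObj _ hX' x y
    exact ⟨g, hg⟩⟩

/-- In `T[A]` (`A` connected, `Π` tempered): connected ⟺ the underlying object of `B^temp(Π)` is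
connected (a single nonempty orbit). [cite: MochizukiSemiAnbd2006, Def A.1(i) p.79] -/
theorem overPrime_isConnectedObj_iff (hG : IsTempered G) {A : BTemp G} (hA : IsConnectedObj A)
    (X : Over' A) : IsConnectedObj X ↔ IsConnectedObj X.obj :=
  ⟨overPrime_isConnectedObj_obj hG hA X, overPrime_isConnectedObj_of_isConnectedObj X⟩

omit [IsTopologicalGroup G] in
/-- In `T[A]`: an object with a point is non-initial. [cite: MochizukiSemiAnbd2006, Appendix p.79] -/
theorem overPrime_isNonemptyObj_of_point {A : BTemp G} (X : Over' A) (x : X.obj.obj.V) :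
    IsNonemptyObj X :=
  ⟨fun hI => (overPrime_isEmpty_of_isInitial hI).false x⟩

omit [IsTopologicalGroup G] in
/-- In `T[A]` initial objects are strict: an arrow out of a non-initial object has non-initial
target. [cite: MochizukiSemiAnbd2006, Appendix p.79] -/
theorem overPrime_isNonemptyObj_of_hom {A : BTemp G} {X Y : Over' A} (f : X ⟶ Y)
    (hX : IsNonemptyObj X) : IsNonemptyObj Y := by
  obtain ⟨x⟩ := overPrime_nonempty_of_isNonemptyObj hX
  exact overPrime_isNonemptyObj_of_point Y (f.hom.hom.hom x)

/-! ### `T[A]` is almost totally epimorphic -/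

omit [IsTopologicalGroup G] in
/-- Epimorphisms of `B^temp(Π)` between objects of `T[A]` are epimorphisms of `T[A]` (the inclusion is
faithful). [folklore] -/
private theorem overPrime_epi_of_epi {A : BTemp G} {X Y : Over' A} (f : X ⟶ Y) [Epi f.hom] :
    Epi f :=
  ⟨fun _ _ w => ObjectProperty.hom_ext _ ((cancel_epi f.hom).mp (congrArg InducedCategory.Hom.hom w))⟩

/-- **`T[A]` is almost totally epimorphic** (`A` connected, `Π` tempered; [SemiAnbd] Rmk. A.1.1 /
Rmk. 3.1.5 for `B^temp(Π)`). [cite: MochizukiSemiAnbd2006, Rmk A.1.1 p.79] -/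
theorem overPrime_isAlmostTotallyEpimorphic (hG : IsTempered G) {A : BTemp G}
    (hA : IsConnectedObj A) : IsAlmostTotallyEpimorphic (Over' A) := by
  refine ⟨fun {X Y} f hX hY => ?_⟩
  obtain ⟨x⟩ := overPrime_nonempty_of_isNonemptyObj hX
  haveI : Epi f.hom :=
    BTemp.epi_of_point_of_isConnectedObj x (overPrime_isConnectedObj_obj hG hA Y hY) f.hom
  exact overPrime_epi_of_epi f

/-! ### `T[A]` is of countably connected type -/

/-- `T[A]` has countable coproducts (computed in `B^temp(Π)`). [cite: MochizukiSemiAnbd2006, Rmk A.1.1 p.79] -/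
theorem overPrime_hasCountableCoproducts (A : BTemp G) : HasCountableCoproducts (Over' A) :=
  ⟨fun J _ => by
    haveI := BTemp.isClosedUnderColimitsOfShape_discrete (G := G) J
    haveI : HasColimitsOfShape (Discrete J) (BTemp G) :=
      hasColimitsOfShape_of_closedUnderColimits _ _
    haveI := admitsHomTo_isClosedUnderColimitsOfShape_discrete A J
    exact hasColimitsOfShape_of_closedUnderColimits (Discrete J) (admitsHomTo A)⟩

/-- A colimit cofan of `T[A]` over a countable index type stays a colimit in `B^temp(Π)` (the
inclusion creates, hence preserves, these coproducts). [folklore] -/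
private theorem overPrime_isColimit_cofan_obj {A : BTemp G} {J : Type} [Countable J]
    {X : J → Over' A} (c : Cofan X) (hc : IsColimit c) :
    Nonempty (IsColimit (Cofan.mk c.pt.obj (fun j => (c.inj j).hom) : Cofan fun j => (X j).obj)) := by
  haveI := BTemp.isClosedUnderColimitsOfShape_discrete (G := G) J
  haveI : HasColimitsOfShape (Discrete J) (BTemp G) := hasColimitsOfShape_of_closedUnderColimits _ _
  haveI := admitsHomTo_isClosedUnderColimitsOfShape_discrete A J
  have hc' : IsColimit (Cofan.mk c.pt c.inj) :=
    IsColimit.ofIsoColimit hc (Cocone.ext (Iso.refl _) (by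
      rintro ⟨j⟩
      simp only [Cofan.mk_ι_app, Iso.refl_hom]
      exact (Category.comp_id _).symm))
  exact ⟨isColimitMapCoconeCofanMkEquiv (admitsHomTo A).ι _ _ (isColimitOfPreserves (admitsHomTo A).ι hc')⟩

/-- **`T[A]` is of countably connected type** (`A` connected, `Π` tempered; [SemiAnbd] Rmk. A.1.1 /
Rmk. 3.1.5 for `B^temp(Π)`): countable coproducts exist; every object is the countable coproduct of
its orbits, which lie in `T[A]` and are connected there; a connected object of `T[A]` (a single
orbit) sees a coproduct as the disjoint union of the `Hom`-sets. [cite: MochizukiSemiAnbd2006, Rmk A.1.1 p.79] -/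
theorem overPrime_isOfCountablyConnectedType (hG : IsTempered G) {A : BTemp G}
    (hA : IsConnectedObj A) : IsOfCountablyConnectedType (Over' A) := by
  refine ⟨overPrime_hasCountableCoproducts A, fun X => ?_, fun {J} _ {Y} c hc B hB => ?_⟩
  · -- orbit decomposition, lifted from `B^temp(Π)`
    obtain ⟨J, hJ, Y, hY, c, ⟨hc⟩, ⟨i⟩⟩ := BTemp.exists_cofan_orbits X.obj
    obtain ⟨pX⟩ := X.property
    let Y' : J → Over' A := fun j => ⟨Y j, ⟨c.inj j ≫ i.hom ≫ pX⟩⟩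
    let c' : Cofan Y' := Cofan.mk (⟨c.pt, ⟨i.hom ≫ pX⟩⟩ : Over' A)
      fun j => ObjectProperty.homMk (c.inj j)
    refine ⟨J, hJ, Y', fun j => overPrime_isConnectedObj_of_isConnectedObj _ (hY j), c', ⟨?_⟩,
      ⟨(admitsHomTo A).isoMk i⟩⟩
    exact Cofan.IsColimit.mk c'
      (fun s => ObjectProperty.homMk (hc.desc (Cofan.mk s.pt.obj fun j => (s.inj j).hom)))
      (fun s j => ObjectProperty.hom_ext _ (hc.fac (Cofan.mk s.pt.obj fun j => (s.inj j).hom) ⟨j⟩))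
      (fun s m hm => ObjectProperty.hom_ext _
        (hc.uniq (Cofan.mk s.pt.obj fun j => (s.inj j).hom) m.hom fun ⟨j⟩ =>
          congrArg InducedCategory.Hom.hom (hm j)))
  · -- a connected `B` sees the coproduct as a disjoint union of `Hom`-sets
    obtain ⟨hcB⟩ := overPrime_isColimit_cofan_obj c hc
    have hB' : IsConnectedObj B.obj := overPrime_isConnectedObj_obj hG hA B hB
    have hbij := BTemp.cofan_bijective _ hcB B.obj hB'
    constructor
    · rintro ⟨j, f⟩ ⟨j', f'⟩ h
      have h' : (⟨j, f.hom⟩ : Σ j, (B.obj ⟶ (Y j).obj)) = ⟨j', f'.hom⟩ :=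
        hbij.1 (congrArg InducedCategory.Hom.hom h :)
      obtain ⟨rfl, hff'⟩ := Sigma.mk.inj_iff.mp h'
      obtain rfl : f = f' := ObjectProperty.hom_ext _ (eq_of_heq hff')
      rfl
    · intro g
      obtain ⟨⟨j, f⟩, hf⟩ := hbij.2 g.hom
      exact ⟨⟨j, ObjectProperty.homMk f⟩, ObjectProperty.hom_ext _ hf⟩

end OverPrime

/-! ### Remark A.1.1 -/

/-- **Remark A.1.1, DISCHARGED** (SemiAnbd Appendix p. 79): a quasi-temperoid is an almost totally
epimorphic category of countably connected type — factorwise (`T[Aᵢ] ⊆ B^temp(Πᵢ)`), then for the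
countable product (strict initial objects in the factors), then along the chart equivalence.
[cite: MochizukiSemiAnbd2006, Rmk A.1.1 p.79] -/
theorem QuasiTemperoidAlmostTotallyEpimorphic_holds : QuasiTemperoidAlmostTotallyEpimorphic.{v₁, u, u₁} := by
  intro Q _ hQ
  obtain ⟨c⟩ := hQ
  haveI := c.countable
  haveI : ∀ i, HasInitial (Over' (c.A i)) := fun i => overPrime_hasInitial (c.A i)
  have h₁ : ∀ i, IsAlmostTotallyEpimorphic (Over' (c.A i)) := fun i =>
    overPrime_isAlmostTotallyEpimorphic (c.isTempered i) (c.isConnectedObj i)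
  have h₂ : ∀ i, IsOfCountablyConnectedType (Over' (c.A i)) := fun i =>
    overPrime_isOfCountablyConnectedType (c.isTempered i) (c.isConnectedObj i)
  have hstrict : ∀ i {X Y : Over' (c.A i)} (_ : X ⟶ Y), IsNonemptyObj X → IsNonemptyObj Y :=
    fun i {_ _} f hX => overPrime_isNonemptyObj_of_hom f hX
  exact ⟨TemperoidTransport.isAlmostTotallyEpimorphic_of_equivalence c.equiv
      (TemperoidProduct.isAlmostTotallyEpimorphic_pi hstrict h₁),
    TemperoidTransport.isOfCountablyConnectedType_of_equivalence c.equiv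
      (TemperoidProduct.isOfCountablyConnectedType_pi hstrict h₂)⟩

end Literature.AnabelianGeometry.SemiGraphs
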